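import Mathlib.Data.ZMod.Basic
import Mathlib.Analysis.SpecialFunctions.Log.Basic
import Mathlib.Algebra.Ring.BooleanRing
import Mathlib.Combinatorics.SimpleGraph.Hasse
import Mathlib.Combinatorics.SimpleGraph.Prod
import Mathlib.Logic.Equiv.Fin.Basic
import Literature.Computability.Cryptography.QubitRegister
import Literature.Computability.Cryptography.QuantumCircuit
import Literature.Computability.Complexity.Circuit
import Literature.Computability.Complexity.Randomized
import Literature.Computability.Complexity.BoolEncodings
import HarnessLib

-- provenance: harness21/H21/H21/Statements/QuantumAdvantage/ShallowCircuits.lean @ cda1ccb (interim HEAD d8f2665); M5 mechanical rewrite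
/-!
# Quantum advantage with shallow circuits: the 2D Hidden Linear Function problem

Family `quantum-advantage` (group G11, trunk `CryptoQuantFine`), statement
**quantum-advantage.S23** (Bravyi–Gosset–König 2018, Theorem 1).

## Informal content

Fix `N` and the `N × N` grid graph on the vertex set `Fin N × Fin N` (nearest neighbours). An
instance of the *2D Hidden Linear Function problem* (2D HLF) is a symmetric binary matrix
`A ∈ {0,1}^{n × n}`, `n = N²`, supported on the edges of the grid, and a binary vector
`b ∈ {0,1}^n`. They define the quadratic form
`q(x) = 2 Σ_{α<β} A_{αβ} x_α x_β + Σ_α b_α x_α ∈ ℤ₄`, `x ∈ 𝔽₂ⁿ`, and the subspace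
`L_q = {x ∈ 𝔽₂ⁿ | ∀ y, q(x ⊕ y) = q(x) + q(y)}` on which `q` is linear, hence of the form
`q(x) = 2 zᵀx (mod 4)` for some `z ∈ 𝔽₂ⁿ` (BGK Eq. (2)). The problem: given `(A, b)`, output any
such `z`. Theorem 1 of BGK: (a) 2D HLF is solved with certainty by a constant-depth quantum
circuit of bounded fan-in (Clifford) gates; (b) any classical probabilistic circuit of bounded
fan-in gates solving 2D HLF with probability `> 7/8` on every input has depth `≥ c log n`.

## Sources

* S. Bravyi, D. Gosset, R. König, *Quantum advantage with shallow circuits*, Science 362 (2018)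
  308–311 (arXiv:1704.00690), Theorem 1 and the section "The 2D Hidden Linear Function
  problem", Eq. (1)–(2).
* summits/fw-bqp/SUMMIT.md (quantum-advantage family summit).

## Mathlib / H21

Mathlib has no hidden-linear-function problem or quantum/classical circuits (grep `HiddenLinear`,
`Bravyi`, `hidden linear`: no hits). Used from Mathlib: `ZMod 4`, the Boolean ring structure on
`Bool` (`x + y` on `Fin N × Fin N → Bool` is pointwise XOR, `Mathlib.Algebra.Ring.BooleanRing`),
the grid graph as the box product `SimpleGraph.pathGraph N □ SimpleGraph.pathGraph N`
(`Mathlib.Combinatorics.SimpleGraph.Hasse`, `.Prod`), `finProdFinEquiv`, `Fin.append`,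
`PMF.toOuterMeasure`, `Real.log`. From H21: `QCircuit`, `QCircuit.depth`, `QCircuit.IsOracleFree`,
`QCircuit.outputPMF`, `cliffordT` (Q1–Q2); `Circuit`, `Circuit.IsOver`, `Circuit.eval`,
`Circuit.depth`, `B2` (G01 Circuit); `uniformProb` (G01 Randomized).

## Design choices

* `HLFInstance N` carries a full matrix `A : (Fin N × Fin N) → (Fin N × Fin N) → Bool`; the grid
  restriction and symmetry are the predicate `HLFInstance.IsValid` (BGK: "A_{αβ} = 0 unless α, β
  are nearest neighbours of the grid"). The diagonal of `A` is irrelevant (`q` sums over `α < β`)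
  and is forced to be `0` by `IsValid` (the grid graph is loopless).
* The order `α < β` on grid vertices is the row-major order transported through
  `finProdFinEquiv : Fin N × Fin N ≃ Fin (N * N)` (the product order on `Fin N × Fin N` is not
  linear and is *not* used).
* Input bit layout (`inLen`, `encodeHLF`): only the `2 N (N-1)` grid-edge entries of `A` and the
  `N²` entries of `b` are input bits — first the horizontal edges `((i,j),(i,j+1))` in row-major
  order of `(i, j) ∈ Fin N × Fin (N-1)`, then the vertical edges `((j,i),(j+1,i))` in the same
  order, then `b` in row-major order; `inLen N = N(N-1) + N(N-1) + N²`. Here `N - 1` only occurs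
  inside `Fin (N * (N - 1))`, which is the correct (empty) type for `N ≤ 1`.
* Quantum side (S23a): the classical input `(A, b)` is presented, as everywhere in Q2, as the
  basis state `|encodeHLF I⟩|0^m⟩` on `inLen N + m` wires; BGK's classically controlled `CZ` and
  `S` gates become `CCZ`/controlled-`S` gates, which have constant-depth Clifford+`T`
  decompositions, and every wire meets a bounded number of them, so constant depth over
  `cliffordT` is the faithful rendering. The answer `z ∈ {0,1}^{N²}` is read off an injective
  tuple `out` of output wires.
* Classical side (S23b): a multi-output probabilistic circuit is a tuple
  `Cs : Fin N × Fin N → Circuit (Fin (inLen N + r))` of single-output G01 straight-line circuits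
  sharing the `inLen N` input bits and the `r` random bits `ρ` (appended after the input via
  `Fin.append`); its depth is the maximum of the depths. Whether the single-output circuits share
  gates is irrelevant for depth (only for size), so nothing is lost. "Bounded fan-in" is
  `IsOver B2` (fan-in `≤ 2`; any bounded fan-in basis changes depth by a constant factor,
  absorbed in `c`). Success `> 7/8` is required on *every* valid input, probability over the
  uniform random string only (BGK Thm 1 wording), via G01's `uniformProb`.
-/

namespace Literature.Computability.QuantumComplexity

open Complexity Cryptography SimpleGraph

/-! ### 2D HLF instances and the quadratic form -/

/-- An instance of the Hidden Linear Function problem on the `N × N` grid: a binary matrix `A`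
indexed by grid vertices and a binary vector `b`. Symmetry of `A` and its support on grid edges
are the separate predicate `HLFInstance.IsValid`. (Bravyi–Gosset–König 2018, "The 2D Hidden
Linear Function problem".) [cite: BravyiGossetKonig2018, "The 2D Hidden Linear Function problem"] -/
structure HLFInstance (N : ℕ) where
  /-- The binary matrix `A_{αβ}` of the quadratic part, indexed by grid vertices. -/
  A : Fin N × Fin N → Fin N × Fin N → Bool
  /-- The binary vector `b_α` of the linear part. -/
  b : Fin N × Fin N → Bool

/-- The `N × N` grid graph (nearest-neighbour adjacency on `Fin N × Fin N`), as the box product of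
two path graphs. (Bravyi–Gosset–König 2018, Fig. 1; Mathlib `SimpleGraph.pathGraph`,
`SimpleGraph.boxProd`.) [cite: BravyiGossetKonig2018, Fig. 1] -/
abbrev gridGraph (N : ℕ) : SimpleGraph (Fin N × Fin N) := pathGraph N □ pathGraph N

namespace HLFInstance

variable {N : ℕ}

/-- Validity of a 2D HLF instance: `A` is symmetric and `A_{αβ} = 0` unless `α, β` are nearest
neighbours on the `N × N` grid (in particular the diagonal vanishes). (Bravyi–Gosset–König 2018,
"The 2D Hidden Linear Function problem".) [cite: BravyiGossetKonig2018, "The 2D Hidden Linear Function problem"] -/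
def IsValid (I : HLFInstance N) : Prop :=
  (∀ u v, I.A u v = I.A v u) ∧ ∀ u v, I.A u v = true → (gridGraph N).Adj u v

/-- The quadratic form `q : 𝔽₂ⁿ → ℤ₄` of an instance,
`q(x) = 2 Σ_{α<β} A_{αβ} x_α x_β + Σ_α b_α x_α (mod 4)`, where `α < β` refers to the row-major
order of grid vertices (`finProdFinEquiv`). (Bravyi–Gosset–König 2018, Eq. (1).) [cite: BravyiGossetKonig2018, Eq. (1] -/
def q (I : HLFInstance N) (x : Fin N × Fin N → Bool) : ZMod 4 :=
  2 * (∑ u, ∑ v,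
        if finProdFinEquiv u < finProdFinEquiv v ∧ I.A u v = true ∧ x u = true ∧ x v = true
        then 1 else 0) +
    ∑ v, if I.b v = true ∧ x v = true then 1 else 0

/-- The subspace `L_q = {x ∈ 𝔽₂ⁿ | ∀ y, q(x ⊕ y) = q(x) + q(y)}` on which `q` is linear; here
`x + y` is pointwise addition in the Boolean ring `Bool`, i.e. XOR. (Bravyi–Gosset–König 2018,
"The 2D Hidden Linear Function problem".) [cite: BravyiGossetKonig2018, "The 2D Hidden Linear Function problem"] -/
def Lq (I : HLFInstance N) : Set (Fin N × Fin N → Bool) :=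
  {x | ∀ y, I.q (x + y) = I.q x + I.q y}

end HLFInstance

/-- The solutions of an HLF instance: the vectors `z ∈ 𝔽₂ⁿ` with `q(x) = 2 zᵀx (mod 4)` for all
`x ∈ L_q`. Such a `z` always exists (the restriction of `q` to `L_q` is a `{0,2}`-valued linear
form). (Bravyi–Gosset–König 2018, Eq. (2).) [cite: BravyiGossetKonig2018, Eq. (2] -/
def hlfSolutions {N : ℕ} (I : HLFInstance N) : Set (Fin N × Fin N → Bool) :=
  {z | ∀ x ∈ I.Lq, I.q x = 2 * ∑ v, (if z v = true ∧ x v = true then 1 else 0)}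

/-! ### Input bit layout -/

/-- The number of input bits of a 2D HLF instance on the `N × N` grid: `N(N-1)` horizontal edge
entries of `A`, `N(N-1)` vertical edge entries of `A`, and the `N²` entries of `b`.
(Bravyi–Gosset–König 2018, Thm 1: input size `Θ(n)`, `n = N²`.) [cite: BravyiGossetKonig2018, Thm 1: input size  Θ(n] -/
def inLen (N : ℕ) : ℕ := N * (N - 1) + N * (N - 1) + N * N

/-- The `k`-th horizontal grid edge, `k ↔ (i, j) ∈ Fin N × Fin (N-1)` in row-major order: the
ordered pair of vertices `((i, j), (i, j+1))`. (Bravyi–Gosset–König 2018, Fig. 1.) [cite: BravyiGossetKonig2018, Fig. 1] -/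
def hEdge {N : ℕ} (k : Fin (N * (N - 1))) : (Fin N × Fin N) × (Fin N × Fin N) :=
  let p := finProdFinEquiv.symm k
  ((p.1, ⟨p.2, by omega⟩), (p.1, ⟨p.2 + 1, by omega⟩))

/-- The `k`-th vertical grid edge, `k ↔ (i, j) ∈ Fin N × Fin (N-1)` in row-major order: the
ordered pair of vertices `((j, i), (j+1, i))`. (Bravyi–Gosset–König 2018, Fig. 1.) [cite: BravyiGossetKonig2018, Fig. 1] -/
def vEdge {N : ℕ} (k : Fin (N * (N - 1))) : (Fin N × Fin N) × (Fin N × Fin N) :=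
  let p := finProdFinEquiv.symm k
  ((⟨p.2, by omega⟩, p.1), (⟨p.2 + 1, by omega⟩, p.1))

/-- The input bit string of a 2D HLF instance: the entries of `A` on the horizontal edges, then on
the vertical edges (both in row-major order, see `hEdge`, `vEdge`), then `b` in row-major order
(`finProdFinEquiv`). For valid instances this determines `(A, b)` (`encodeHLF_injective`).
(Bravyi–Gosset–König 2018, Thm 1.) [cite: BravyiGossetKonig2018, Thm 1] -/
def encodeHLF {N : ℕ} (I : HLFInstance N) : Fin (inLen N) → Bool :=
  Fin.append
    (Fin.append (fun k => I.A (hEdge k).1 (hEdge k).2) (fun k => I.A (vEdge k).1 (vEdge k).2))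
    (fun k => I.b (finProdFinEquiv.symm k))

/-! ### API lemmas -/

section API

variable {N : ℕ}

/-- Horizontal edges are grid edges. (Bravyi–Gosset–König 2018, Fig. 1.) [cite: BravyiGossetKonig2018, Fig. 1] -/
theorem gridGraph_adj_hEdge (k : Fin (N * (N - 1))) :
    (gridGraph N).Adj (hEdge k).1 (hEdge k).2 := by
  simp [hEdge, boxProd_adj, pathGraph_adj]

/-- Vertical edges are grid edges. (Bravyi–Gosset–König 2018, Fig. 1.) [cite: BravyiGossetKonig2018, Fig. 1] -/
theorem gridGraph_adj_vEdge (k : Fin (N * (N - 1))) :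
    (gridGraph N).Adj (vEdge k).1 (vEdge k).2 := by
  simp [vEdge, boxProd_adj, pathGraph_adj]

/-- The zero vector lies in `L_q` (`q(0) = 0`). (Bravyi–Gosset–König 2018.) [cite: BravyiGossetKonig2018] -/
theorem HLFInstance.zero_mem_Lq (I : HLFInstance N) : (fun _ => false) ∈ I.Lq := by
  intro y
  have h0 : I.q (fun _ => false) = 0 := by simp [HLFInstance.q]
  have : ((fun _ => false) + y : Fin N × Fin N → Bool) = y := by
    funext v; show xor false (y v) = y v; simp
  rw [this, h0, zero_add]

/-- Every instance has a solution: `q` restricted to `L_q` is a `{0,2}`-valued linear form, hence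
of the form `2 zᵀx`. (Bravyi–Gosset–König 2018, discussion of Eq. (2).) [cite: BravyiGossetKonig2018, discussion of Eq. (2] -/
def hlfSolutions_nonempty : Prop :=
  ∀ (I : HLFInstance N),
    (hlfSolutions I).Nonempty

/-- The input encoding is injective on valid instances (a valid `A` is determined by its values on
the ordered grid edges listed by `hEdge`, `vEdge`, by symmetry). (Bravyi–Gosset–König 2018.) [cite: BravyiGossetKonig2018] -/
def encodeHLF_injective : Prop :=
  Set.InjOn (encodeHLF (N := N)) {I | I.IsValid}

end API

/-! ### Target statements -/

/-- **quantum-advantage.S23** (first half: constant-depth quantum circuits solve 2D HLF;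
summits/fw-bqp/SUMMIT.md; Bravyi–Gosset–König, Science 362 (2018), Theorem 1). There is a
constant `d` such that for every grid size `N ≥ 2` some oracle-free Clifford+`T` circuit `C` of
depth at most `d`, on the `inLen N` input wires plus `m` ancillas, together with an injective
choice `out` of `N²` output wires, solves 2D HLF with certainty: for every valid instance `I`,
running `C` on `|encodeHLF I⟩|0^m⟩` and measuring all wires yields, with probability `1`, an
outcome whose restriction to the output wires lies in `hlfSolutions I`. [cite: BravyiGossetKonigScience2018, Theorem 1] -/
def hlf_quantum_constant_depth : Prop :=
  ∃ d : ℕ, ∀ N : ℕ, 2 ≤ N →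
      ∃ (m : ℕ) (C : QCircuit cliffordT (inLen N + m)) (out : Fin N × Fin N → Fin (inLen N + m)),
        Function.Injective out ∧ C.IsOracleFree ∧ C.depth ≤ d ∧
        ∀ I : HLFInstance N, I.IsValid →
          (C.outputPMF 0 (encodeHLF I)).toOuterMeasure
            {y | (fun v => y (out v)) ∈ hlfSolutions I} = 1

/-- **quantum-advantage.S23** (second half: classical logarithmic depth lower bound;
summits/fw-bqp/SUMMIT.md; Bravyi–Gosset–König, Science 362 (2018), Theorem 1). There are `c > 0`
and `N₀` such that for all `N ≥ N₀`: if a classical probabilistic circuit with fan-in `≤ 2` gates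
— a tuple `Cs` of single-output circuits over `B2`, one per grid vertex, reading the `inLen N`
input bits followed by `r` shared uniformly random bits `ρ` — outputs an element of
`hlfSolutions I` with probability `> 7/8` for *every* valid instance `I`, then its depth
`max_v depth (Cs v)` is at least `c log N`. [cite: BravyiGossetKonigScience2018, Theorem 1] -/
def hlf_classical_depth_lower_bound : Prop :=
  ∃ c : ℝ, 0 < c ∧ ∃ N₀ : ℕ, ∀ N ≥ N₀,
      ∀ (r : ℕ) (Cs : Fin N × Fin N → Circuit (Fin (inLen N + r))),
        (∀ v, (Cs v).IsOver B2) →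
        (∀ I : HLFInstance N, I.IsValid →
          (7 / 8 : ℝ) < uniformProb r
            {ρ | (fun v => (Cs v).eval (Fin.append (encodeHLF I) fun i => ρ.getD i false)) ∈
              hlfSolutions I}) →
        c * Real.log N ≤ ⨆ v, ((Cs v).depth : ℝ)

/-! ### BGK Lemma 1: every instance has a solution (discharge of `hlfSolutions_nonempty`)

Bravyi–Gosset–König, arXiv:1704.00690 §3, Lemma 1 (the discussion of Eq. (2) in the Science
text): "The set `L_q` is a linear subspace of `𝔽₂ⁿ` and `q(x) ∈ {0,2}` for all `x ∈ L_q`. The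
restriction of `q` to `L_q` is a linear function, that is, there exists a vector `z ∈ {0,1}ⁿ` such
that `q(x) = 2zᵀx` for all `x ∈ L_q`." The printed proof is followed step by step; its last step
("`l(x ⊕ y) = l(x) ⊕ l(y)` for all `x, y ∈ L_q`. It follows that `l(x) = zᵀx (mod 2)` for some
vector `z`") is the elementary extension lemma `exists_dotProduct_eq_of_additive` below, proved by
induction on the coordinates (no linear algebra over the field `𝔽₂` is imported). Lemma 1 uses
nothing about `A`, `b` beyond `q(0) = 0`, so no validity hypothesis appears. -/

section LemmaOne

variable {N : ℕ}

/-- `L_q` is closed under addition — BGK Lemma 1, first assertion ("`L_q` is a linear subspace of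
`𝔽₂ⁿ`"): `q(x ⊕ x' ⊕ y) = q(x) + q(x' ⊕ y) = q(x) + q(x') + q(y) = q(x ⊕ x') + q(y)`.
[cite: BravyiGossetKonigScience2018, §3 Lemma 1 (arXiv:1704.00690)] -/
theorem HLFInstance.add_mem_Lq (I : HLFInstance N) {x x' : Fin N × Fin N → Bool}
    (hx : x ∈ I.Lq) (hx' : x' ∈ I.Lq) : x + x' ∈ I.Lq := by
  intro y
  rw [add_assoc, hx (x' + y), hx' y, hx x', add_assoc]

/-- `q(x) + q(x) = 0`, i.e. `q(x) ∈ {0, 2}`, for `x ∈ L_q` — BGK Lemma 1, second assertion: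
`0 = q(0) = q(x ⊕ x) = 2q(x)`. [cite: BravyiGossetKonigScience2018, §3 Lemma 1 (arXiv:1704.00690)] -/
theorem HLFInstance.q_add_q_eq_zero (I : HLFInstance N) {x : Fin N × Fin N → Bool}
    (hx : x ∈ I.Lq) : I.q x + I.q x = 0 := by
  have hxx : x + x = fun _ => false := by
    funext v; show xor (x v) (x v) = false; simp
  have h0 : I.q (fun _ => false) = 0 := by simp [HLFInstance.q]
  rw [← hx x, hxx, h0]

/-- Boolean arithmetic: `a + a = 0` in `𝔽₂`. [folklore] -/
private theorem bool_add_self (a : Bool) : a + a = 0 := by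
  cases a <;> rfl

/-- Extension of additive maps over `𝔽₂` — the step "`l(x ⊕ y) = l(x) ⊕ l(y)` for all
`x, y ∈ L_q`. It follows that `l(x) = zᵀx (mod 2)` for some vector `z ∈ {0,1}ⁿ`" of the proof of
BGK Lemma 1, made explicit: an additively closed set `L` of Boolean vectors supported inside the
finite set `s` of coordinates, and a map `ℓ` additive on `L`, admit `z` with `ℓ(x) = zᵀx` for
all `x ∈ L` (arithmetic in the Boolean ring `Bool`: `+` is XOR, `*` is AND, `zᵀx = z ⬝ᵥ x`).
Induction on `s`: for a coordinate `i`, either every `x ∈ L` has `x_i = 0`, or some `w ∈ L` has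
`w_i = 1`; in the latter case extend from `{x ∈ L | x_i = 0}` (which contains `x ⊕ w` whenever
`x_i = 1`) and correct `z` by `(zᵀw + ℓ(w)) e_i`. [cite: BravyiGossetKonigScience2018, §3 Lemma 1, proof (arXiv:1704.00690)] -/
theorem exists_dotProduct_eq_of_additive {ι : Type*} [Fintype ι] [DecidableEq ι]
    (s : Finset ι) :
    ∀ (L : Set (ι → Bool)) (ℓ : (ι → Bool) → Bool),
      (∀ x ∈ L, ∀ y ∈ L, x + y ∈ L) →
      (∀ x ∈ L, ∀ y ∈ L, ℓ (x + y) = ℓ x + ℓ y) →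
      (∀ x ∈ L, ∀ v, v ∉ s → x v = false) →
      ∃ z : ι → Bool, ∀ x ∈ L, ℓ x = z ⬝ᵥ x := by
  induction s using Finset.induction_on with
  | empty =>
    intro L ℓ _ hadd hsupp
    refine ⟨fun _ => false, fun x hx => ?_⟩
    have hx0 : x = 0 := funext fun v => hsupp x hx v (Finset.notMem_empty v)
    subst hx0
    have h := hadd 0 hx 0 hx
    rw [add_zero, bool_add_self] at h
    rw [h, dotProduct_zero]
  | insert i s hi ih =>
    intro L ℓ hL hadd hsupp
    by_cases hw : ∃ w ∈ L, w i = true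
    · obtain ⟨w, hwL, hwi⟩ := hw
      obtain ⟨z, hz⟩ := ih {x | x ∈ L ∧ x i = false} ℓ
        (fun x hx y hy => ⟨hL x hx.1 y hy.1, by
          show xor (x i) (y i) = false
          rw [hx.2, hy.2]; rfl⟩)
        (fun x hx y hy => hadd x hx.1 y hy.1)
        (fun x hx v hv => by
          by_cases hvi : v = i
          · subst hvi; exact hx.2
          · exact hsupp x hx.1 v fun h => (Finset.mem_insert.mp h).elim hvi hv)
      refine ⟨z + Pi.single i (z ⬝ᵥ w + ℓ w), fun x hx => ?_⟩
      rw [add_dotProduct, single_dotProduct]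
      by_cases hxi : x i = true
      · have hxw : x + w ∈ {x | x ∈ L ∧ x i = false} :=
          ⟨hL x hx w hwL, by
            show xor (x i) (w i) = false
            rw [hxi, hwi]; rfl⟩
        have h1 := hz (x + w) hxw
        rw [hadd x hx w hwL, dotProduct_add] at h1
        rw [hxi]
        revert h1
        generalize ℓ x = a; generalize ℓ w = b; generalize z ⬝ᵥ x = c; generalize z ⬝ᵥ w = d
        revert a b c d; decide
      · have hxi' : x i = false := Bool.eq_false_iff.mpr hxi
        rw [hxi', hz x ⟨hx, hxi'⟩]
        generalize z ⬝ᵥ x = a; generalize z ⬝ᵥ w + ℓ w = b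
        revert a b; decide
    · push Not at hw
      exact ih L ℓ hL hadd fun x hx v hv => by
        by_cases hvi : v = i
        · subst hvi; exact Bool.eq_false_iff.mpr (hw x hx)
        · exact hsupp x hx v fun h => (Finset.mem_insert.mp h).elim hvi hv

/-- BGK's `l : L_q → 𝔽₂`, `l(x) = 1` if `q(x) = 2` and `l(x) = 0` if `q(x) = 0`, as a map on `ℤ₄`.
[cite: BravyiGossetKonigScience2018, §3 Lemma 1, proof (arXiv:1704.00690)] -/
private def halfBit (a : ZMod 4) : Bool := decide (a = 2)

/-- `l` is additive on `{0, 2} ⊆ ℤ₄`. [folklore] -/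
private theorem halfBit_add {a b : ZMod 4} (ha : a + a = 0) (hb : b + b = 0) :
    halfBit (a + b) = halfBit a + halfBit b := by
  revert a b; decide

/-- Doubling `𝔽₂ → ℤ₄`, `c ↦ 2c`, as an additive map (`2(a ⊕ b) = 2a + 2b (mod 4)`). [folklore] -/
private def dblHom : Bool →+ ZMod 4 where
  toFun c := if c = true then 2 else 0
  map_zero' := by decide
  map_add' := by decide

/-- On `{0, 2} ⊆ ℤ₄`, `a = 2 l(a)`. [folklore] -/
private theorem eq_dblHom_halfBit {a : ZMod 4} (ha : a + a = 0) : a = dblHom (halfBit a) := by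
  revert a; decide

/-- **Discharge of `hlfSolutions_nonempty`: BGK Lemma 1** (Bravyi–Gosset–König, arXiv:1704.00690
§3, Lemma 1 = the discussion of Eq. (2) in Science 362 (2018): "The restriction of `q` to `L_q`
is a linear function, that is, there exists a vector `z ∈ {0,1}ⁿ` such that `q(x) = 2zᵀx` for all
`x ∈ L_q`"). Proof as printed: `L_q` is additively closed (`HLFInstance.add_mem_Lq`),
`q(x) ∈ {0,2}` on `L_q` (`HLFInstance.q_add_q_eq_zero`), `l = halfBit ∘ q` is additive on `L_q`,
hence `l(x) = zᵀx` for some `z` (`exists_dotProduct_eq_of_additive`), and then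
`q(x) = 2 l(x) = 2 zᵀx (mod 4)`. No validity hypothesis on the instance is needed (BGK use none).
[cite: BravyiGossetKonigScience2018, §3 Lemma 1 (arXiv:1704.00690)] -/
theorem hlfSolutions_nonempty_holds : hlfSolutions_nonempty (N := N) := by
  intro I
  obtain ⟨z, hz⟩ := exists_dotProduct_eq_of_additive (Finset.univ : Finset (Fin N × Fin N)) I.Lq
    (fun x => halfBit (I.q x))
    (fun x hx y hy => I.add_mem_Lq hx hy)
    (fun x hx y hy => by
      show halfBit (I.q (x + y)) = halfBit (I.q x) + halfBit (I.q y)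
      rw [hx y]
      exact halfBit_add (I.q_add_q_eq_zero hx) (I.q_add_q_eq_zero hy))
    (fun x _ v hv => absurd (Finset.mem_univ v) hv)
  refine ⟨z, fun x hx => ?_⟩
  rw [eq_dblHom_halfBit (I.q_add_q_eq_zero hx), hz x hx, dotProduct, map_sum, Finset.mul_sum]
  refine Finset.sum_congr rfl fun v _ => ?_
  generalize z v = a; generalize x v = b
  revert a b; decide

end LemmaOne

end Literature.Computability.QuantumComplexity
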